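import Literature.MathematicalPhysics.QuantumFieldTheory.Balaban1983to89.B4Sect5CubeBounds

/-!
# `Balaban1983to89.B10Eq63WalkUniform` — the x-UNIFORM generalized random walk expansion of `(T + x·1)⁻¹` on the
# unit lattice for (5.6)-operators: the unit-lattice SHAPE of [Balaban1985UV3] p. 272 ∕ [Balaban1988RG2Cluster] p. 13
# (*"G̃₃(x) has the same properties as G̃₂, especially it can be represented by a generalized random walk expansion"*,
# x on a COMPACT range), kernel-checked from [Balaban1983RegularityDecay] Sect. 5 (5.11)–(5.17) as PROVED in the tree

statement-level skeleton of published theorems with citation tags; proofs where landed; nothing here is a claim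
about the Yang–Mills mass gap.

T. Bałaban, *Ultraviolet stability of three-dimensional lattice pure gauge field theories*, Commun. Math. Phys. **102**
(1985) 255–275 [Balaban1985UV3], p. 272; *Renormalization group approach to lattice gauge field theories. II*,
Commun. Math. Phys. **116** (1988) 1–22 [Balaban1988RG2Cluster], p. 13 after (2.7); *Regularity and decay of lattice
Green's functions*, Commun. Math. Phys. **89** (1983) 571–597 [Balaban1983RegularityDecay], Sect. 5 (5.6),
(5.11)–(5.17) pp. 594–596.  Unit b2b-balaban-beta-an4 gen 90 (BINDER row D4 OWNER; cell pub-balaban), remark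
R-an4g90-1 of the row's HANDOFF made kernel.  Imports `B4Sect5CubeBounds` (lit-balaban p13-g2) ONLY; nothing edited.

WHY (row (D4), NODE A.3 = terminal leaf (T2) G-IF-10, cell GAPS: *"What remains unproved in print: a generalized random
walk expansion of G̃₃(x) … with term bounds of the (3.108) type UNIFORM in x ≥ 0 …; the expansion combinatorics with the
extra positive almost-local x-vertex … is not written"*; `B10Eq63Rep` consumes the expansion on the COMPACT range
`x ∈ [0, 2γ₁]`).  ON THE UNIT LATTICE ℤ^d THE x-UNIFORMITY IS FREE for operators obeying [B4] (5.6): if `T` satisfies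
(5.6) on `Λ` with `(γ₀, c₀, δ₀)` then `T + x·1` satisfies (5.6) with `(γ₀, c₀ + a, δ₀)` for every `x ∈ [0, a]`
(`hyp56_add_smul_one`: the lower bound gains `x ≥ 0`, the diagonal gains `x ≤ a = a·e^{−δ₀·0}`), hence the tree's
generalized random walk expansion (5.17) WITH (5.15) DISCHARGED (`B4Sect5CubeBounds.hasSum517_lattice'`, whose cube size
`M` and weight `θ(M)` are explicit functions of `d, N, γ₀, c₀, δ₀`) applies to `(T + x·1)⁻¹` with ONE cube size and ONE
set of constants for ALL `x ∈ [0, a]` (`hasSum517_add_smul_one_uniform`) — the expansion parameter is `1∕M` (α(M) → 0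
in (5.15)), not the size of the x-vertex, so the *«bounded-not-small x-vertex»* of the G-IF-10 UPDATE is no obstruction
on THIS route.

WHAT THIS DOES NOT DO (the located residual, unchanged): (i) the TORUS carrier — the cube system (5.11) is typed on
finite subsets of ℤ^d (`B4Sect5Torus` proves the Sect. 5 THEOREM on the torus by finite Combes–Thomas, not the
expansion); (ii) the FIELD-LOCALISATION of the walk terms in the gauge field U that the cluster expansion needs (terms
depending on U only through their localization domain — requires the entrywise locality of U ↦ C*Δ_k(U)C, NODE O.2);
(iii) (5.6) itself for Bałaban's `C*Δ_k(U)C + …` (positivity = [B9] Thm 3.11-type, decay = Thm 3.10∕3.12 — NODE O + the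
located leaves), and everything G̃₂ owes (G-B9-10 (a)(b)(c)); (iv) `B10LogDet63.G3WalkBound`'s entrywise `e^{−r·d(dom)}`
shape is not derived here (the tree's (5.17) is an operator-valued walk sum; its levels are summable in operator norm).
Row D4 class UNCHANGED (instance 0∕1; critical-path width 0; D4 DISCHARGE NO DATE); NOT B12 Thm 2, NOT BetaPertH, NOT
continuum, NOT Clay.  HONEST DEPENDENCY: continuum YM on T⁴ ⇐ BetaPertH ∧ nine spine estimates (0/9 proved); BetaPertH
⇐ (D1) ∧ (D4) ∧ CAP+tail; G-an2-4 gates asym, D1 and NE2/3/4.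
-/

namespace Literature.MathematicalPhysics.QuantumFieldTheory.Balaban1983to89.B10Eq63WalkUniform

open Literature.MathematicalPhysics.QuantumFieldTheory.Balaban1983to89
open Literature.MathematicalPhysics.QuantumFieldTheory.Balaban1983to89.B4Sect5RandomWalk (walkTerm517 aFac bFac)
open Literature.MathematicalPhysics.QuantumFieldTheory.Balaban1983to89.B4Sect5CubeBounds
  (kR thetaConst pFam hFam cFam hasSum517_lattice')
open scoped Matrix

variable {d N : ℕ} {Λ : Finset (Fin d → ℤ)}

/-- **(5.6) IS STABLE UNDER THE x-VERTEX**: if `T` satisfies [B4] (5.6) on `Λ` with constants `(γ₀, c₀, δ₀)`, then for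
every `0 ≤ x ≤ a` the operator `T + x·1` satisfies (5.6) with `(γ₀, c₀ + a, δ₀)` — symmetric; `⟨v,(T + x)v⟩ ≥ (γ₀ + x)‖v‖²
≥ γ₀‖v‖²`; `|(T + x·1)(p,q)| ≤ c₀e^{−δ₀|p−q|} + x·[p = q] ≤ (c₀ + a)e^{−δ₀|p−q|}`.
[cite: Balaban1983RegularityDecay, (5.6) p.594; Balaban1985UV3, p.272] -/
theorem hyp56_add_smul_one {T : Matrix (B4.Idx Λ N) (B4.Idx Λ N) ℝ} {γ₀ c₀ δ₀ a x : ℝ}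
    (hT : B4.Hyp56 Λ T γ₀ c₀ δ₀) (hx0 : 0 ≤ x) (hxa : x ≤ a) :
    B4.Hyp56 Λ (T + x • (1 : Matrix (B4.Idx Λ N) (B4.Idx Λ N) ℝ)) γ₀ (c₀ + a) δ₀ := by
  obtain ⟨hs, hl, hk⟩ := hT
  refine ⟨?_, ?_, ?_⟩
  · -- symmetry
    exact hs.add (Matrix.isSymm_one.smul x)
  · -- coercivity: the x-vertex is non-negative
    intro v
    have h1 : ∀ p, v p * (T + x • (1 : Matrix (B4.Idx Λ N) (B4.Idx Λ N) ℝ)).mulVec v p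
        = v p * T.mulVec v p + x * v p ^ 2 := by
      intro p
      rw [Matrix.add_mulVec, Matrix.smul_mulVec, Matrix.one_mulVec]
      simp only [Pi.add_apply, Pi.smul_apply, smul_eq_mul]
      ring
    simp_rw [h1]
    rw [Finset.sum_add_distrib, ← Finset.mul_sum]
    have hx : 0 ≤ x * ∑ p, v p ^ 2 := mul_nonneg hx0 (Finset.sum_nonneg fun p _ => sq_nonneg _)
    linarith [hl v]
  · -- kernel bound: the diagonal gains at most `a`
    intro p q
    have ha : 0 ≤ a := hx0.trans hxa
    have hexp : 0 < Real.exp (-(δ₀ * dist (p.1 : Fin d → ℤ) (q.1 : Fin d → ℤ))) := Real.exp_pos _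
    rw [Matrix.add_apply, Matrix.smul_apply, smul_eq_mul]
    by_cases hpq : p = q
    · subst hpq
      rw [Matrix.one_apply_eq, mul_one, dist_self, mul_zero, neg_zero, Real.exp_zero, mul_one]
      have := hk p p
      rw [dist_self, mul_zero, neg_zero, Real.exp_zero, mul_one] at this
      calc |T p p + x| ≤ |T p p| + |x| := abs_add_le _ _
        _ ≤ c₀ + a := by rw [abs_of_nonneg hx0]; exact add_le_add this hxa
    · rw [Matrix.one_apply_ne hpq, mul_zero, add_zero]
      calc |T p q| ≤ c₀ * Real.exp (-(δ₀ * dist (p.1 : Fin d → ℤ) (q.1 : Fin d → ℤ))) := hk p q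
        _ ≤ (c₀ + a) * Real.exp (-(δ₀ * dist (p.1 : Fin d → ℤ) (q.1 : Fin d → ℤ))) :=
          mul_le_mul_of_nonneg_right (le_add_of_nonneg_right ha) hexp.le

/-- **THE x-UNIFORM GENERALIZED RANDOM WALK EXPANSION OF `(T + x·1)⁻¹` ON THE UNIT LATTICE** (the unit-lattice shape of
*"G̃₃(x) … can be represented by a generalized random walk expansion"* with x on a compact range): for `T` with (5.6)
on `Λ ⊂ ℤ^d` (constants `γ₀ > 0`, `c₀ ≥ 0`, `δ₀ > 0`) and `a ≥ 0`, ONE cube size `M` — any `M ≥ 5` with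
`M > K_R(d, N, γ₀, c₀ + a, δ₀)` and `M > Θ₁(d, N, γ₀, c₀ + a, δ₀)` — gives, for EVERY `x ∈ [0, a]`, the convergent walk form
(5.17) of `(T + x·1)⁻¹` built from the cube system (5.11)–(5.12) of `T + x·1` ((5.15) discharged inside
`hasSum517_lattice'`; cube size, (5.15)-constant α(M) and walk weight θ(M) INDEPENDENT of x).
[cite: Balaban1985UV3, p.272; Balaban1988RG2Cluster, p.13; Balaban1983RegularityDecay, (5.11)–(5.17) pp.594–596] -/
theorem hasSum517_add_smul_one_uniform {T : Matrix (B4.Idx Λ N) (B4.Idx Λ N) ℝ} {γ₀ c₀ δ₀ a : ℝ}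
    (hγ : 0 < γ₀) (hc : 0 ≤ c₀) (hδ : 0 < δ₀) (ha : 0 ≤ a) (hT : B4.Hyp56 Λ T γ₀ c₀ δ₀) {M : ℕ} (hM : 5 ≤ M)
    (hMR : kR d N γ₀ (c₀ + a) δ₀ < M) (hMθ : thetaConst d N γ₀ (c₀ + a) δ₀ < M) {x : ℝ} (hx0 : 0 ≤ x) (hxa : x ≤ a) :
    HasSum
      (walkTerm517 (aFac (hFam N M Λ) (cFam M (T + x • (1 : Matrix (B4.Idx Λ N) (B4.Idx Λ N) ℝ))))
        (bFac (T + x • (1 : Matrix (B4.Idx Λ N) (B4.Idx Λ N) ℝ)) (pFam N M Λ) (hFam N M Λ)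
          (cFam M (T + x • (1 : Matrix (B4.Idx Λ N) (B4.Idx Λ N) ℝ)))))
      (T + x • (1 : Matrix (B4.Idx Λ N) (B4.Idx Λ N) ℝ))⁻¹ :=
  hasSum517_lattice' hγ (add_nonneg hc ha) hδ (hyp56_add_smul_one hT hx0 hxa) hM hMR hMθ

/-- The same on the WHOLE compact range at once: `∀ x ∈ [0, a]`. [cite: Balaban1985UV3, p.272; Balaban1988RG2Cluster, p.13] -/
theorem hasSum517_uniform_on_Icc {T : Matrix (B4.Idx Λ N) (B4.Idx Λ N) ℝ} {γ₀ c₀ δ₀ a : ℝ}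
    (hγ : 0 < γ₀) (hc : 0 ≤ c₀) (hδ : 0 < δ₀) (ha : 0 ≤ a) (hT : B4.Hyp56 Λ T γ₀ c₀ δ₀) {M : ℕ} (hM : 5 ≤ M)
    (hMR : kR d N γ₀ (c₀ + a) δ₀ < M) (hMθ : thetaConst d N γ₀ (c₀ + a) δ₀ < M) :
    ∀ x ∈ Set.Icc (0 : ℝ) a, HasSum
      (walkTerm517 (aFac (hFam N M Λ) (cFam M (T + x • (1 : Matrix (B4.Idx Λ N) (B4.Idx Λ N) ℝ))))
        (bFac (T + x • (1 : Matrix (B4.Idx Λ N) (B4.Idx Λ N) ℝ)) (pFam N M Λ) (hFam N M Λ)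
          (cFam M (T + x • (1 : Matrix (B4.Idx Λ N) (B4.Idx Λ N) ℝ)))))
      (T + x • (1 : Matrix (B4.Idx Λ N) (B4.Idx Λ N) ℝ))⁻¹ :=
  fun _ hx => hasSum517_add_smul_one_uniform hγ hc hδ ha hT hM hMR hMθ hx.1 hx.2

/-- **SUCH A CUBE SIZE EXISTS** (the constants are real numbers): for every `(d, N, γ₀, c₀, a, δ₀)` there is `M ≥ 5`
exceeding `K_R` and `Θ₁` at `c₀ + a`. [cite: Balaban1983RegularityDecay, p.596 «Finally we fix M»] -/
theorem exists_cubeSize (d N : ℕ) (γ₀ c₀ a δ₀ : ℝ) :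
    ∃ M : ℕ, 5 ≤ M ∧ kR d N γ₀ (c₀ + a) δ₀ < M ∧ thetaConst d N γ₀ (c₀ + a) δ₀ < M := by
  obtain ⟨M, hM⟩ := exists_nat_gt (max 5 (max (kR d N γ₀ (c₀ + a) δ₀) (thetaConst d N γ₀ (c₀ + a) δ₀)))
  refine ⟨M, ?_, ?_, ?_⟩
  · have : (5 : ℝ) < M := (le_max_left _ _).trans_lt hM
    exact_mod_cast this.le
  · exact ((le_max_left _ _).trans (le_max_right _ _)).trans_lt hM
  · exact ((le_max_right _ _).trans (le_max_right _ _)).trans_lt hM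

end Literature.MathematicalPhysics.QuantumFieldTheory.Balaban1983to89.B10Eq63WalkUniform
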